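import Summits.ValiantsHypothesis.ValiantsHypothesis.Theses.LangWeilTransfer
import Summits.ValiantsHypothesis.ValiantsHypothesis.Theorems.LangWeilTransferLangWeilBoundFinOne
import Literature.RingTheory.MvPolynomial.KaltofenNoetherFormsThm7Proofs
import Literature.RingTheory.MvPolynomial.OstrowskiNorms
import Literature.NumberTheory.Sieve.BombieriAsymptoticSieveSigma0Comb
import Mathlib.RingTheory.MvPolynomial.IrreducibleQuadratic

/-!
# LangWeilTransfer, support item `GoodReduction` (stmt-ValiantsHypothesis-6377) — the absolutely
# irreducible slice, PROVED (partial range)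

Route `LangWeilTransfer` of `ValiantsHypothesis`, support item `GoodReduction` (effective
Noether–Ostrowski over the geometric factors): for `Q ∈ ℤ[x_0..x_m]` irreducible over `ℚ` with
`≤ f` geometric components, outside a set of `≤ a((f+1)(m+1)(deg Q+1)(log₂ wt Q+1))^a` primes, `Q mod p`
has an absolutely irreducible factor over `GaloisField p f'`, `f' ≤ f`. This file proves the
conclusion VERBATIM in the slice where `Q` itself is absolutely irreducible over `ℚ` (one geometric
component): then `Q mod p` is absolutely irreducible over `𝔽_p = GaloisField p 1` for every prime not
dividing one nonzero integer `N` — the value at the coefficients of `Q` of one of KALTOFEN'S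
EFFECTIVE NOETHER IRREDUCIBILITY FORMS (tree theorem `kaltofen1995_thm7_holds`, Kaltofen 1995
Thm. 7: degree `≤ 12d⁶`, `‖Φ‖₁ ≤ (2d)^{12d⁷+12d⁶n+32d⁶}`, uniform over all fields including positive
characteristic) — so `#bad ≤ log₂ |N| ≤ 124·P⁹`, `P = (f+1)(m+1)(d+1)(log₂ wt Q+1)`, a POLYNOMIAL
count (Schmidt's Cor. V.2B would give a doubly exponential one, as the item warns). Degree `1` and
the univariate case are handled directly (a linear form stays absolutely irreducible modulo every
prime not dividing one of its coefficients; an absolutely irreducible univariate polynomial is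
linear). What remains OPEN of the item is the Galois descent for `f ≥ 2` geometric components
(Kaltofen's Thm. 8, also a tree theorem, applied to a factor over its field of definition, plus
height bounds for that factor and a Kronecker model of its coefficient field). Honest framing:
bookkeeping inside a dormant route; nothing here bears on VP ≠ VNP.
-/

noncomputable section

open MvPolynomial

-- the summit and the problem share the name `ValiantsHypothesis` (D-0017 single-conjunct layout)
set_option linter.dupNamespace false

namespace Summit.ValiantsHypothesis.ValiantsHypothesis.Theorems.LangWeilTransfer

open Literature.NumberTheory.DiophantineGeometry (IsAbsIrreducible)
open Literature.RingTheory.MvPolynomial (l1Norm natAbs_eval_le kaltofen1995_thm7_holds)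
open Literature.Computability.AlgebraicComplexity (weight)

/-- Evaluating an integer form at an integer point pushed into a `ℤ`-algebra. (The `ℤ`-algebra
structure is an implicit argument so that the lemma rewrites under any instance.) -/
theorem aeval_intCast_eq {ι K : Type*} [CommRing K] {inst : Algebra ℤ K} (x : ι → ℤ)
    (P : MvPolynomial ι ℤ) :
    @aeval ℤ K ι _ _ inst (fun i => (x i : K)) P = ((eval x P : ℤ) : K) := by
  have h := eval₂_comp_left (algebraMap ℤ K) (RingHom.id ℤ) x P
  rw [RingHom.comp_id] at h
  have hx : (fun i => (x i : K)) = (algebraMap ℤ K) ∘ x := by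
    funext i; exact (eq_intCast (algebraMap ℤ K) (x i)).symm
  rw [hx, aeval_def, ← h, eq_intCast]
  rfl

/-- `log₂ (A^E · B^D) ≤ E (log₂ A + 1) + D (log₂ B + 1)`. -/
theorem log_two_pow_mul_pow_le (A B E D : ℕ) :
    Nat.log 2 (A ^ E * B ^ D) ≤ E * (Nat.log 2 A + 1) + D * (Nat.log 2 B + 1) := by
  have hA : A ≤ 2 ^ (Nat.log 2 A + 1) := (Nat.lt_pow_succ_log_self one_lt_two A).le
  have hB : B ≤ 2 ^ (Nat.log 2 B + 1) := (Nat.lt_pow_succ_log_self one_lt_two B).le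
  have h : A ^ E * B ^ D ≤ 2 ^ (E * (Nat.log 2 A + 1) + D * (Nat.log 2 B + 1)) := by
    rw [pow_add, pow_mul, pow_mul, pow_right_comm 2 E, pow_right_comm 2 D]
    · exact Nat.mul_le_mul (Nat.pow_le_pow_left hA _) (Nat.pow_le_pow_left hB _)
  calc Nat.log 2 (A ^ E * B ^ D) ≤ Nat.log 2 (2 ^ (E * (Nat.log 2 A + 1) + D * (Nat.log 2 B + 1))) :=
        Nat.log_mono_right h
    _ = _ := Nat.log_pow one_lt_two _

/-- **Linear forms are absolutely irreducible.** Over a field `K`, a polynomial of total degree `≤ 1`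
with a nonzero coefficient at a monomial of degree `1` is absolutely irreducible. -/
theorem isAbsIrreducible_of_linear {K : Type*} [Field K] {n : ℕ} {q : MvPolynomial (Fin n) K}
    (hq : q.totalDegree ≤ 1) {s : Fin n →₀ ℕ} (hs : (s.sum fun _ e => e) = 1)
    (hc : q.coeff s ≠ 0) : IsAbsIrreducible q := by
  unfold IsAbsIrreducible
  set L := AlgebraicClosure K
  have hinj : Function.Injective (algebraMap K L) := (algebraMap K L).injective
  have hcL : (MvPolynomial.map (algebraMap K L) q).coeff s ≠ 0 := by
    rw [coeff_map]; exact (map_ne_zero_iff _ hinj).mpr hc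
  have hdeg : (MvPolynomial.map (algebraMap K L) q).totalDegree = 1 := by
    apply le_antisymm
    · exact (Finset.sup_mono (support_map_subset _ _)).trans hq
    · rw [← hs]; exact le_totalDegree (mem_support_iff.mpr hcL)
  refine irreducible_of_totalDegree_eq_one hdeg fun x hx => ?_
  have hx0 : x ≠ 0 := by
    intro h0
    obtain ⟨y, hy⟩ := hx s
    rw [h0, zero_mul] at hy
    exact hcL hy
  exact isUnit_iff_ne_zero.mpr hx0

/-- **An absolutely irreducible univariate polynomial is linear.** -/
theorem totalDegree_le_one_of_isAbsIrreducible_fin_one {K : Type*} [Field K]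
    {Q : MvPolynomial (Fin 1) K}
    (hQ : Irreducible (MvPolynomial.map (algebraMap K (AlgebraicClosure K)) Q)) :
    Q.totalDegree ≤ 1 := by
  set L := AlgebraicClosure K
  have hirr : Irreducible (uniqueAlgEquiv L (Fin 1) (MvPolynomial.map (algebraMap K L) Q)) :=
    (MulEquiv.irreducible_iff (uniqueAlgEquiv L (Fin 1))).mpr hQ
  have hdeg1 := IsAlgClosed.degree_eq_one_of_irreducible L hirr
  rw [uniqueAlgEquiv_map, Polynomial.degree_map] at hdeg1
  have hnat : (uniqueAlgEquiv K (Fin 1) Q).natDegree = 1 :=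
    Polynomial.natDegree_eq_of_degree_eq_some hdeg1
  -- every monomial in the support has weight ≤ the degree of the univariate image
  rw [totalDegree]
  refine Finset.sup_le fun s hs => ?_
  have hs' : s = Finsupp.single default (s default) := Finsupp.unique_single s
  have hcoeff : (uniqueAlgEquiv K (Fin 1) Q).coeff (s default) ≠ 0 := by
    rw [coeff_uniqueAlgEquiv, ← hs']; exact mem_support_iff.mp hs
  have hle := Polynomial.le_natDegree_of_ne_zero hcoeff
  rw [hnat] at hle
  calc (s.sum fun _ e => e) = s default := by
        rw [hs', Finsupp.sum_single_index rfl, Finsupp.single_eq_same]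
    _ ≤ 1 := hle

/-- **The absolutely irreducible slice of `GoodReduction`, core**: for `Q ∈ ℤ[x_0..x_m]` absolutely
irreducible over `ℚ` there is a nonzero integer `N` with `log₂ |N| ≤ 124·((m+1)(d+1)(log₂ wt Q+1))⁹`
such that `Q mod p` is absolutely irreducible over `𝔽_p` for every prime `p ∤ N`
(Kaltofen's Noether forms for `d ≥ 2`, one coefficient for `d = 1`). -/
theorem exists_good_reduction_modulus (m : ℕ) (Q : MvPolynomial (Fin (m + 1)) ℤ)
    (hQ : IsAbsIrreducible (MvPolynomial.map (Int.castRingHom ℚ) Q)) :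
    ∃ N : ℤ, N ≠ 0 ∧
      Nat.log 2 N.natAbs ≤ 124 * ((m + 1) * (Q.totalDegree + 1) * (Nat.log 2 (weight Q) + 1)) ^ 9 ∧
      ∀ (p : ℕ) [Fact p.Prime], ¬ (p : ℤ) ∣ N →
        IsAbsIrreducible (K := GaloisField p 1) (MvPolynomial.map (algebraMap ℤ (GaloisField p 1)) Q) := by
  classical
  set d := Q.totalDegree with hd
  set W := weight Q with hW
  obtain ⟨P, hP⟩ : ∃ P, (m + 1) * (d + 1) * (Nat.log 2 W + 1) = P := ⟨_, rfl⟩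
  rw [hP]
  have hQ0 : Q ≠ 0 := by
    rintro rfl
    rw [map_zero] at hQ
    exact hQ.ne_zero rfl
  have hdQ : (MvPolynomial.map (Int.castRingHom ℚ) Q).totalDegree = d := by
    simp only [hd, totalDegree, support_map_of_injective _ (Int.castRingHom ℚ).injective_int]
  -- every coefficient is bounded by the weight, which is positive
  have hcoeffW : ∀ e, (Q.coeff e).natAbs ≤ W := by
    intro e
    by_cases he : e ∈ Q.support
    · exact Finset.single_le_sum (f := fun e => (Q.coeff e).natAbs) (fun _ _ => Nat.zero_le _) he
    · rw [notMem_support_iff.mp he]; exact Nat.zero_le _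
  obtain ⟨e₀, he₀⟩ := MvPolynomial.ne_zero_iff.mp hQ0
  have hW1 : 1 ≤ W := le_trans (Int.natAbs_pos.mpr he₀) (hcoeffW e₀)
  have hP1 : 1 ≤ P := by
    have : 0 < P := by rw [← hP]; positivity
    omega
  -- reduction of `Q` modulo `p` and its coefficients
  have hred : ∀ (p : ℕ) [Fact p.Prime] (e : Fin (m + 1) →₀ ℕ),
      (MvPolynomial.map (algebraMap ℤ (GaloisField p 1)) Q).coeff e = ((Q.coeff e : ℤ) : GaloisField p 1) := by
    intro p _ e; rw [coeff_map, eq_intCast]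
  have hreddeg : ∀ (p : ℕ) [Fact p.Prime],
      (MvPolynomial.map (algebraMap ℤ (GaloisField p 1)) Q).totalDegree ≤ d := fun p _ =>
    Finset.sup_mono (support_map_subset _ _)
  have hcast : ∀ (p : ℕ) [Fact p.Prime] (c : ℤ), ¬ (p : ℤ) ∣ c → ((c : ℤ) : GaloisField p 1) ≠ 0 :=
    fun p _ c hc h => hc ((CharP.intCast_eq_zero_iff (GaloisField p 1) p c).mp h)
  -- `d ≥ 1`
  have hd1 : 1 ≤ d := by
    by_contra h
    have h0 : Q.totalDegree = 0 := by omega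
    rw [totalDegree_eq_zero_iff_eq_C] at h0
    have hc : Q.coeff 0 ≠ 0 := fun hc => hQ0 (by rw [h0, hc, C_0])
    apply hQ.not_isUnit
    rw [h0, map_C, map_C]
    refine (isUnit_iff_ne_zero.mpr ?_).map C
    exact (map_ne_zero_iff _ (algebraMap ℚ (AlgebraicClosure ℚ)).injective).mpr
      ((map_ne_zero_iff _ (Int.castRingHom ℚ).injective_int).mpr hc)
  rcases Nat.lt_or_ge d 2 with hdlt | hd2
  · -- the linear case `d = 1`
    have hd1' : d = 1 := by omega
    obtain ⟨s₀, hs₀mem, hs₀⟩ : ∃ s ∈ Q.support, (s.sum fun _ e => e) = 1 := by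
      obtain ⟨s, hs, h⟩ := Finset.exists_mem_eq_sup Q.support (support_nonempty.mpr hQ0)
        (fun s : Fin (m + 1) →₀ ℕ => s.sum fun _ e => e)
      exact ⟨s, hs, by rw [← h]; exact hd1'⟩
    refine ⟨Q.coeff s₀, mem_support_iff.mp hs₀mem, ?_, fun p _ hp => ?_⟩
    · calc Nat.log 2 (Q.coeff s₀).natAbs ≤ Nat.log 2 W := Nat.log_mono_right (hcoeffW s₀)
        _ ≤ P := by
          have : Nat.log 2 W + 1 ≤ P := by
            rw [← hP]; exact Nat.le_mul_of_pos_left _ (by positivity)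
          omega
        _ ≤ 124 * P ^ 9 := by
          calc P ≤ P ^ 9 := Nat.le_self_pow (by norm_num) P
            _ ≤ 124 * P ^ 9 := Nat.le_mul_of_pos_left _ (by norm_num)
    · refine isAbsIrreducible_of_linear ((hreddeg p).trans (by omega)) hs₀ ?_
      rw [hred]; exact hcast p _ hp
  · -- `d ≥ 2`: the univariate case is impossible, then Kaltofen's Noether forms
    have hm : 2 ≤ m + 1 := by
      rcases m with _ | m
      · exfalso
        have := totalDegree_le_one_of_isAbsIrreducible_fin_one hQ
        omega
      · omega
    obtain ⟨ι, hι, Φ, hΦb, hΦ⟩ := kaltofen1995_thm7_holds.{0} (m + 1) d hm hd2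
    -- over `ℚ` some form does not vanish at the coefficients of `Q`
    have hex : ∃ t, aeval (fun e => (MvPolynomial.map (Int.castRingHom ℚ) Q).coeff e) (Φ t) ≠ 0 := by
      by_contra hall
      push Not at hall
      have h := (hΦ ℚ (MvPolynomial.map (Int.castRingHom ℚ) Q) hdQ.le).mp hall
      rcases h with h | h
      · omega
      · exact h hQ
    obtain ⟨t₀, ht₀⟩ := hex
    set N : ℤ := eval (fun e => Q.coeff e) (Φ t₀) with hN
    have hcoeffℚ : (fun e => (MvPolynomial.map (Int.castRingHom ℚ) Q).coeff e) =
        fun e => ((Q.coeff e : ℤ) : ℚ) := by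
      funext e; rw [coeff_map, eq_intCast]
    rw [hcoeffℚ, aeval_intCast_eq] at ht₀
    have hN0 : N ≠ 0 := fun h => ht₀ (by rw [← hN, h, Int.cast_zero])
    refine ⟨N, hN0, ?_, fun p _ hp => ?_⟩
    · -- the size of `N`
      have hNle : N.natAbs ≤ l1Norm (Φ t₀) * W ^ (12 * d ^ 6) :=
        natAbs_eval_le (Φ t₀) _ W hW1 hcoeffW _ (hΦb t₀).1
      have h1 : N.natAbs ≤ (2 * d) ^ (12 * d ^ 7 + 12 * d ^ 6 * (m + 1) + 32 * d ^ 6) * W ^ (12 * d ^ 6) :=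
        hNle.trans (Nat.mul_le_mul_right _ (hΦb t₀).2)
      have h2 := (Nat.log_mono_right h1).trans (log_two_pow_mul_pow_le _ _ _ _)
      refine h2.trans ?_
      -- polynomial bookkeeping in `P = (m+1)(d+1)(log₂ W + 1)`
      have hdP : d + 1 ≤ P := by
        rw [← hP]
        calc d + 1 = 1 * (d + 1) * 1 := by ring
          _ ≤ (m + 1) * (d + 1) * (Nat.log 2 W + 1) :=
            Nat.mul_le_mul (Nat.mul_le_mul_right _ (by omega)) (by omega)
      have hmP : m + 1 ≤ P := by
        rw [← hP]
        calc m + 1 = (m + 1) * 1 * 1 := by ring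
          _ ≤ (m + 1) * (d + 1) * (Nat.log 2 W + 1) :=
            Nat.mul_le_mul (Nat.mul_le_mul_left _ (by omega)) (by omega)
      have hLP : Nat.log 2 W + 1 ≤ P := by
        rw [← hP]; exact Nat.le_mul_of_pos_left _ (by positivity)
      have hlog2d : Nat.log 2 (2 * d) + 1 ≤ 2 * P := by
        have : Nat.log 2 (2 * d) < 2 * d := Nat.log_lt_self 2 (by omega)
        omega
      have hd7 : d ^ 7 ≤ P ^ 7 := Nat.pow_le_pow_left (by omega) 7
      have hd6 : d ^ 6 ≤ P ^ 6 := Nat.pow_le_pow_left (by omega) 6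
      have hE : 12 * d ^ 7 + 12 * d ^ 6 * (m + 1) + 32 * d ^ 6 ≤ 56 * P ^ 8 := by
        have e1 : d ^ 6 * (m + 1) ≤ P ^ 8 := by
          calc d ^ 6 * (m + 1) ≤ P ^ 6 * P := Nat.mul_le_mul hd6 hmP
            _ = P ^ 7 := by ring
            _ ≤ P ^ 8 := Nat.pow_le_pow_right hP1 (by norm_num)
        have e2 : d ^ 7 ≤ P ^ 8 := hd7.trans (Nat.pow_le_pow_right hP1 (by norm_num))
        have e3 : d ^ 6 ≤ P ^ 8 := hd6.trans (Nat.pow_le_pow_right hP1 (by norm_num))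
        have e5 : 12 * d ^ 6 * (m + 1) = 12 * (d ^ 6 * (m + 1)) := by ring
        rw [e5]
        omega
      have hA : (12 * d ^ 7 + 12 * d ^ 6 * (m + 1) + 32 * d ^ 6) * (Nat.log 2 (2 * d) + 1) ≤
          112 * P ^ 9 := by
        calc _ ≤ 56 * P ^ 8 * (2 * P) := Nat.mul_le_mul hE hlog2d
          _ = 112 * P ^ 9 := by ring
      have hB : 12 * d ^ 6 * (Nat.log 2 W + 1) ≤ 12 * P ^ 9 := by
        calc 12 * d ^ 6 * (Nat.log 2 W + 1) ≤ 12 * P ^ 6 * P :=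
              Nat.mul_le_mul (Nat.mul_le_mul_left _ hd6) hLP
          _ = 12 * P ^ 7 := by ring
          _ ≤ 12 * P ^ 9 := Nat.mul_le_mul_left _ (Nat.pow_le_pow_right hP1 (by norm_num))
      calc (12 * d ^ 7 + 12 * d ^ 6 * (m + 1) + 32 * d ^ 6) * (Nat.log 2 (2 * d) + 1) +
            12 * d ^ 6 * (Nat.log 2 W + 1) ≤ 112 * P ^ 9 + 12 * P ^ 9 := Nat.add_le_add hA hB
        _ = 124 * P ^ 9 := by ring
    · -- good reduction at `p ∤ N`
      set Qp := MvPolynomial.map (algebraMap ℤ (GaloisField p 1)) Q with hQp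
      have hiff := hΦ (GaloisField p 1) Qp (hreddeg p)
      have hnot : ¬ ∀ t, aeval (fun e => Qp.coeff e) (Φ t) = 0 := by
        intro hall
        have h0 := hall t₀
        have hcoeffp : (fun e => Qp.coeff e) = fun e => ((Q.coeff e : ℤ) : GaloisField p 1) := by
          funext e; exact hred p e
        rw [hcoeffp, aeval_intCast_eq, ← hN] at h0
        exact hcast p N hp h0
      rw [hiff] at hnot
      push Not at hnot
      exact hnot.2

/-- **`GoodReduction` on the absolutely irreducible slice** (stmt-ValiantsHypothesis-6377, partial
range): the item's conclusion, verbatim, with exponent `a = 124`, for every `Q ∈ ℤ[x_0..x_m]` that is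
absolutely irreducible over `ℚ` (and any `f ≥ 1`; the witness has `f' = 1`, `Q₁ = Q mod p`). -/
theorem goodReduction_of_isAbsIrreducible :
    ∃ a : ℕ, ∀ (m f : ℕ) (Q : MvPolynomial (Fin (m + 1)) ℤ),
      IsAbsIrreducible (MvPolynomial.map (Int.castRingHom ℚ) Q) → 0 < f →
      ∃ bad : Finset ℕ, bad.card ≤ a * ((f + 1) * (m + 1) * (Q.totalDegree + 1) *
          (Nat.log 2 (weight Q) + 1)) ^ a ∧
        ∀ (p : ℕ) [Fact p.Prime], p ∉ bad → ∃ f' : ℕ, 0 < f' ∧ f' ≤ f ∧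
          ∃ Q₁ : MvPolynomial (Fin (m + 1)) (GaloisField p f'),
            Irreducible (MvPolynomial.map (algebraMap (GaloisField p f')
              (AlgebraicClosure (GaloisField p f'))) Q₁) ∧
            Q₁ ∣ MvPolynomial.map (algebraMap ℤ (GaloisField p f')) Q := by
  refine ⟨124, fun m f Q hQ hf => ?_⟩
  obtain ⟨N, hN0, hNlog, hgood⟩ := exists_good_reduction_modulus m Q hQ
  refine ⟨N.natAbs.primeFactors, ?_, fun p _ hp => ⟨1, Nat.one_pos, hf, _, hgood p ?_, dvd_rfl⟩⟩
  · refine (Literature.NumberTheory.Sieve.BombieriSieve.card_primeFactors_le_log _).trans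
      (hNlog.trans ?_)
    obtain ⟨P, hP⟩ : ∃ P, (m + 1) * (Q.totalDegree + 1) * (Nat.log 2 (weight Q) + 1) = P :=
      ⟨_, rfl⟩
    rw [hP]
    have hPf : P ≤ (f + 1) * (m + 1) * (Q.totalDegree + 1) * (Nat.log 2 (weight Q) + 1) := by
      rw [← hP, mul_assoc (f + 1), mul_assoc (f + 1)]
      exact Nat.le_mul_of_pos_left _ (by omega)
    have hP1 : 1 ≤ (f + 1) * (m + 1) * (Q.totalDegree + 1) * (Nat.log 2 (weight Q) + 1) :=
      Nat.succ_le_of_lt (by positivity)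
    calc 124 * P ^ 9 ≤ 124 * ((f + 1) * (m + 1) * (Q.totalDegree + 1) * (Nat.log 2 (weight Q) + 1)) ^ 9 :=
          Nat.mul_le_mul_left _ (Nat.pow_le_pow_left hPf 9)
      _ ≤ 124 * ((f + 1) * (m + 1) * (Q.totalDegree + 1) * (Nat.log 2 (weight Q) + 1)) ^ 124 :=
          Nat.mul_le_mul_left _ (Nat.pow_le_pow_right hP1 (by norm_num))
  · intro h
    exact hp (Nat.mem_primeFactors.mpr ⟨Fact.out, Int.natCast_dvd.mp h, Int.natAbs_ne_zero.mpr hN0⟩)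

end Summit.ValiantsHypothesis.ValiantsHypothesis.Theorems.LangWeilTransfer
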